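import Literature.MathematicalPhysics.QuantumFieldTheory.Balaban1983to89.T3TiltDescent
import HarnessLib

/-!
# `Balaban1983to89.T3HeightwiseDensityBounds` — Bałaban's ultraviolet stability bounds (5)/(6) of [Balaban1985UV3] READ HEIGHTWISE on the
# pinned d = 3 tower (`T3Family`, smearing `ℰp`, densities `heightDensity`): the `K`-UNIFORM bound of the normalised height-`n` density
# `Z_K⁻¹ρ_{K−n}` as a HYPOTHESIS SCHEMA (never asserted), its derivation from the printed currency ((5) upper at `k = K − n` over (6)), and
# the measure-theoretic consequence the compactness step consumes (domination of the descended run laws by product Haar)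

Work item `wi-87190` (kind cite, family constructive-qft; consumer route-QuantumFields-UVClassRigidity crux A = stmt-QuantumFields-26905,
`stub_heightwiseCompactness`: Banach–Alaoglu / Dunford–Pettis at every height from `K`-uniform density bounds).

WHAT IS PRINTED ([Balaban1985UV3] = T. Bałaban, CMP 102 (1985) 255–275).  p. 256 (1)–(2): `ρ₀ = exp[−(1/g₀²)A(U) − E]`, «E is a constant
including normalization terms and vacuum energy renormalization counterterms … we prefer to give an inductive definition during the proof»,
`ρ_{k+1} = Tρ_k`; (5): «χ(U) exp[−(1/g_k²)A^η(U_k(U)) − O(1)|T₁^{(k)}|] ≤ ρ_k(U) ≤ exp O(1)|T₁^{(k)}|», `|T₁^{(k)}| = (L^kε)^{−3}|T_ε|`,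
`g_k = g(L^kε)^{1/2}`; p. 257 L1 «the constant O(1) is independent of ε, k, g_k in a bounded set»; Theorem 1 p. 257: «The lattice
approximations of the three-dimensional pure Yang–Mills theory with a semi-simple compact group Lie G are ultraviolet stable in the sense
that the sequence of densities ρ_k … satisfies the bounds (5)»; (6) p. 257: «∫dU ρ_k = ∫dU T^kρ₀ = ∫dU ρ₀ = Z^ε», «they imply uniform in ε
bounds for the partition function Z^ε».

THE HEIGHTWISE READING.  On the tower, run `K` has `ε_K = L^{−K}`, terminal (unit) coupling `γ`, and `g_k² = γL^{k−K}`; HEIGHT `n` is the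
lattice of spacing `L^{−n}` = level `K − n` of run `K`, with `|T₁^{(K−n)}| = (2L^{m+n})³` sites and coupling `g_{K−n}² = γL^{−n}` — BOTH
INDEPENDENT OF `K`.  Hence (5) at `k = K − n` bounds Bałaban's `ρ_{K−n} = e^{−E_K}·(tree density)` by `exp(O(1)(2L^{m+n})³)` with ONE
constant for all `K ≥ n` (also in the audit reading `B10.Thm1PrintedCompact` of the cell — the coupling window at height `n` is the single
point `γL^{−n}`), and (6) with (5) at `k = K` bounds `e^{−E_K}Z_K` from both sides uniformly in `K`; in the QUOTIENT `Z_K⁻¹ρ_{K−n}` —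
the density of the descended run law `(D_{n,K})_*Gibbs_K` with respect to product Haar (`T3TiltDescent.map_descendTo_restrict_eq_withDensity`)
— Bałaban's constant `E_K` CANCELS: `Z_K⁻¹ρ_{K−n} ≤ C_n` a.e., `C_n` independent of `K` (§1 `HeightwiseUpperBound`, derived in §2 from the
printed currency `Bounds5UpperAtHeight` ∧ `PartitionBounds6`).

HONEST FRAMING (as in `T3AlphaInputsAC`, `T3UnitLawDensityEML`; dossier `pub/lit-balaban/ALPHA-T3AC-PAGES.md` §4).  Print proves (5) for ITS
run objects (the averaging (10)+(0.4) of [Balaban1985Averaging], `E` of (62)/(64), a semi-simple compact `G`, terminal spacing `ε₀(g)` — in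
tower units: terminal coupling `γ` small).  For the tree's pinned `ℰp` Radon–Nikodym densities on `SU(2)` the bounds are the CONSTRUCTION
STATEMENT of the cell (located-unprinted at the exact-Haar-compatibility point), so every `def … : Prop` below is a PREDICATE in `(F, γ)`
(resp. `(F, γ, E)`) — a hypothesis schema a route takes as a crux or discharges from pub-balaban3d's end theorem — and NOT a named fact;
nothing of Bałaban's is asserted here.  The `theorem`s are bookkeeping: §2 quotient algebra, §3 `withDensity` monotonicity.  The lower
bound of (5)/(47) is recorded in the same quotient currency on the all-small plaquette set (`HeightwiseLowerBoundOnSmall`; the constant form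
uses the regularity of the minimiser, [Balaban1985Variational] Thm 1, to bound `A^η(U_k(U))` on that set — flagged in its docstring).

References: T. Bałaban, CMP 102 (1985) 255–275 [Balaban1985UV3] ((1)–(6) pp.256–257, Thm 1 p.257, (41) p.266, (46)–(47) p.267, (62) p.271,
(64) p.273); T. Bałaban, CMP 98 (1985) 17–51 [Balaban1985Averaging] ((10) p.19); T. Bałaban, CMP 102 (1985) 277–309 [Balaban1985Variational]
(Thm 1 p.279).
-/

noncomputable section

open MeasureTheory Filter Topology
open Literature.MathematicalPhysics.QuantumFieldTheory.Balaban1983to89.T3ContinuumYM3Torus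
open Literature.MathematicalPhysics.QuantumFieldTheory.Balaban1983to89.T3LevelShift
open Literature.MathematicalPhysics.QuantumFieldTheory.Balaban1983to89.T3NestedUnitLaws
open Literature.MathematicalPhysics.QuantumFieldTheory.Balaban1983to89.T3UnitLawDensityEML
open Literature.MathematicalPhysics.QuantumFieldTheory.Balaban1983to89.T3UnitScaleTilt
open Literature.MathematicalPhysics.QuantumFieldTheory.Balaban1983to89.T3RestrictedUnitDensity
open Literature.MathematicalPhysics.QuantumFieldTheory.Balaban1983to89.T3TiltDescent
open Literature.MathematicalPhysics.QuantumFieldTheory.Balaban1983to89.Missing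
open Literature.MathematicalPhysics.QuantumFieldTheory.Balaban1983to89.T4Continuum

namespace Literature.MathematicalPhysics.QuantumFieldTheory.Balaban1983to89.T3HeightwiseDensityBounds

/-! ## §1 The heightwise bounds in the quotient currency `Z_K⁻¹ρ_{K−n}` (hypothesis schemas) -/

/-- **HEIGHTWISE `K`-UNIFORM UPPER STABILITY BOUND** (schema, NOT asserted): for every height `n` there is `C_n` such that for every run
`K ≥ n` the normalised height-`n` density `Z_K⁻¹ρ_{K−n}` (`heightDensity` on the whole space, over the partition function of run `K`; the
density of `(D_{n,K})_*Gibbs_K` with respect to product Haar) is `≤ C_n` almost everywhere.  This is (5) p. 256, upper half («ρ_k(U) ≤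
exp O(1)|T₁^{(k)}|», «O(1) … independent of ε, k, g_k in a bounded set») at `k = K − n`, divided by the `ε`-uniform lower bound of the
partition function of (6) p. 257 — Bałaban's normalisation `E` of (1) cancels in the quotient.  Printed for Bałaban's run objects (Thm 1
p. 257); for the pinned `ℰp` densities it is the cell's construction statement (module docstring). [cite: Balaban1985UV3, (5) p.256, (6) p.257, Thm 1 p.257] -/
def HeightwiseUpperBound (F : T3Family) (γ : ℝ) : Prop :=
  ∀ n : ℕ, ∃ C : ℝ, ∀ (K : ℕ) (hK : n ≤ K),
    ∀ᵐ V ∂(fieldMeasure (F.P n) 0 (Matrix.specialUnitaryGroup (Fin 2) ℂ)),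
      (partitionFn (G := Matrix.specialUnitaryGroup (Fin 2) ℂ) (F.P K) ((F.scheme ℰp γ).β K))⁻¹ * heightDensity F γ hK Set.univ V ≤ C

/-- **HEIGHTWISE `K`-UNIFORM LOWER STABILITY BOUND ON THE ALL-SMALL SET** (schema, NOT asserted): for every height `n` there are a
plaquette threshold `δ_n > 0` and `c_n > 0` such that for every run `K ≥ n`, almost everywhere on the height-`n` fields all of whose
plaquette variables lie within `δ_n` of the identity (`PlaqSmall δ_n`), `Z_K⁻¹ρ_{K−n} ≥ c_n`.  This is the lower half of (5) p. 256
(«χ(U) exp[−(1/g_k²)A^η(U_k(U)) − O(1)|T₁^{(k)}|] ≤ ρ_k(U)», `χ` = the characteristic function of (4) «|U(∂p) − 1| < ε₁») at `k = K − n` —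
where on the set `χ = 1` the minimiser's action `A^η(U_k(U))` is `O(1)|T₁^{(k)}|` by the regularity of `U_k` ([Balaban1985Variational] Thm 1;
this conversion is a READING, not printed in (5)) and `1/g_{K−n}² = L^n/γ` does not depend on `K` — divided by the upper bound of the
partition function from (5) at `k = K` and (6). [cite: Balaban1985UV3, (4)-(5) p.256, (6) p.257, (47) p.267] -/
def HeightwiseLowerBoundOnSmall (F : T3Family) (γ : ℝ) : Prop :=
  ∀ n : ℕ, ∃ δ c : ℝ, 0 < δ ∧ 0 < c ∧ ∀ (K : ℕ) (hK : n ≤ K),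
    ∀ᵐ V ∂(fieldMeasure (F.P n) 0 (Matrix.specialUnitaryGroup (Fin 2) ℂ)), PlaqSmall δ V →
      c ≤ (partitionFn (G := Matrix.specialUnitaryGroup (Fin 2) ℂ) (F.P K) ((F.scheme ℰp γ).β K))⁻¹ * heightDensity F γ hK Set.univ V

/-! ## §2 The printed currency: (5) upper at height `n` and (6), for Bałaban's normalised densities `e^{−E_K}ρ` -/

/-- **(5), UPPER HALF, AT HEIGHT `n`** for the densities in BAŁABAN'S NORMALISATION `e^{−E_K}·ρ` (`E : ℕ → ℝ`, one constant per run, the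
`E` of (1) p. 256; the tree's `heightDensity` is built with `E = 0`) — schema, NOT asserted: for every `n` ONE constant `O1` with
`e^{−E_K}ρ_{K−n} ≤ exp(O1·|T₁^{(K−n)}|)` a.e. for all `K ≥ n`, `|T₁^{(K−n)}| = ((F.P n).sitesPerDir 0)³ = (2L^{m+n})³` («O(1) is
independent of ε, k, g_k in a bounded set»; at height `n` the coupling `g_{K−n}² = γL^{−n}` is one point, so the audit reading
`B10.Thm1PrintedCompact` gives the same). [cite: Balaban1985UV3, (5) p.256 and p.257 L1] -/
def Bounds5UpperAtHeight (F : T3Family) (γ : ℝ) (E : ℕ → ℝ) : Prop :=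
  ∀ n : ℕ, ∃ O1 : ℝ, ∀ (K : ℕ) (hK : n ≤ K),
    ∀ᵐ V ∂(fieldMeasure (F.P n) 0 (Matrix.specialUnitaryGroup (Fin 2) ℂ)),
      Real.exp (-E K) * heightDensity F γ hK Set.univ V ≤ Real.exp (O1 * ((F.P n).sitesPerDir 0 : ℝ) ^ 3)

/-- **(6): `ε`-UNIFORM TWO-SIDED BOUNDS OF THE PARTITION FUNCTION** in Bałaban's normalisation — schema, NOT asserted:
`exp(−O1·|T₁|) ≤ e^{−E_K}Z_K ≤ exp(O1·|T₁|)` for all runs `K`, `|T₁| = ((F.P 0).sitesPerDir 0)³ = (2L^m)³` the number of unit-lattice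
sites («∫dU ρ_k = ∫dU T^kρ₀ = ∫dU ρ₀ = Z^ε … they imply uniform in ε bounds for the partition function Z^ε»; `Z_K` = the tree's
`partitionFn` of run `K`, i.e. `∫ρ₀` with `E = 0`). [cite: Balaban1985UV3, (6) p.257] -/
def PartitionBounds6 (F : T3Family) (γ : ℝ) (E : ℕ → ℝ) : Prop :=
  ∃ O1 : ℝ, ∀ K : ℕ,
    Real.exp (-(O1 * ((F.P 0).sitesPerDir 0 : ℝ) ^ 3)) ≤
        Real.exp (-E K) * partitionFn (G := Matrix.specialUnitaryGroup (Fin 2) ℂ) (F.P K) ((F.scheme ℰp γ).β K) ∧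
      Real.exp (-E K) * partitionFn (G := Matrix.specialUnitaryGroup (Fin 2) ℂ) (F.P K) ((F.scheme ℰp γ).β K) ≤
        Real.exp (O1 * ((F.P 0).sitesPerDir 0 : ℝ) ^ 3)

variable {F : T3Family} {γ : ℝ}

/-- **THE QUOTIENT READING**: (5)-upper at every height and (6), for ANY run normalisations `E_K`, give the heightwise `K`-uniform bound
of the normalised density with `C_n = exp(O1·|T₁^{(K−n)}| + O1'·|T₁|)` — Bałaban's `E_K` cancels (`γ ≥ 0` for `Z_K > 0`). [cite: Balaban1985UV3, (5)-(6) pp.256-257] -/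
theorem heightwiseUpperBound_of_bounds5 (hγ : 0 ≤ γ) {E : ℕ → ℝ} (h5 : Bounds5UpperAtHeight F γ E) (h6 : PartitionBounds6 F γ E) :
    HeightwiseUpperBound F γ := by
  intro n
  obtain ⟨O1, hO1⟩ := h5 n
  obtain ⟨O1', hO1'⟩ := h6
  refine ⟨Real.exp (O1 * ((F.P n).sitesPerDir 0 : ℝ) ^ 3) / Real.exp (-(O1' * ((F.P 0).sitesPerDir 0 : ℝ) ^ 3)), fun K hK => ?_⟩
  set Z := partitionFn (G := Matrix.specialUnitaryGroup (Fin 2) ℂ) (F.P K) ((F.scheme ℰp γ).β K) with hZdef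
  have hZ : 0 < Z := partitionFn_pos' _ (F.scheme_β_nonneg ℰp hγ K)
  have hlow : Real.exp (-(O1' * ((F.P 0).sitesPerDir 0 : ℝ) ^ 3)) ≤ Real.exp (-E K) * Z := (hO1' K).1
  filter_upwards [hO1 K hK] with V hV
  -- `Z⁻¹ ρ = (e^{-E} ρ) / (e^{-E} Z)`
  have hq : Z⁻¹ * heightDensity F γ hK Set.univ V = (Real.exp (-E K) * heightDensity F γ hK Set.univ V) / (Real.exp (-E K) * Z) := by
    rw [mul_div_mul_left _ _ (Real.exp_pos _).ne', div_eq_inv_mul]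
  rw [hq]
  have hpos : 0 < Real.exp (-E K) * Z := mul_pos (Real.exp_pos _) hZ
  calc Real.exp (-E K) * heightDensity F γ hK Set.univ V / (Real.exp (-E K) * Z)
      ≤ Real.exp (O1 * ((F.P n).sitesPerDir 0 : ℝ) ^ 3) / (Real.exp (-E K) * Z) :=
        div_le_div_of_nonneg_right hV hpos.le
    _ ≤ Real.exp (O1 * ((F.P n).sitesPerDir 0 : ℝ) ^ 3) / Real.exp (-(O1' * ((F.P 0).sitesPerDir 0 : ℝ) ^ 3)) :=
        div_le_div_of_nonneg_left (Real.exp_pos _).le (Real.exp_pos _) hlow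

/-! ## §3 What the compactness step consumes: domination of the descended run laws by product Haar -/

/-- **DOMINATION OF THE DESCENDED RUN LAWS** (`γ ≥ 0`): under `HeightwiseUpperBound`, for every height `n` there is `C ≥ 0` with
`(D_{n,K})_*Gibbs_K ≤ C · dU^{(n)}` (setwise) for every run `K ≥ n` — by `map_descendTo_restrict_eq_withDensity` (the descended law IS
`dU^{(n)}.withDensity (Z_K⁻¹ρ_{K−n})`) and monotonicity of `withDensity`.  Uniform domination by one finite measure is the form in which
weak-⋆ (Dunford–Pettis / Banach–Alaoglu in `L^∞ = (L¹)^*`) compactness of the height-`n` laws along the cutoff is applied. [cite: Balaban1985UV3, (5)-(6) pp.256-257] -/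
theorem map_descendTo_le_smul_fieldMeasure (hγ : 0 ≤ γ) (h : HeightwiseUpperBound F γ) (n : ℕ) :
    ∃ C : ℝ, 0 ≤ C ∧ ∀ (K : ℕ) (hK : n ≤ K),
      Measure.map (descendTo F ℰp n K hK) (gibbsK F ℰp γ K) ≤
        ENNReal.ofReal C • fieldMeasure (F.P n) 0 (Matrix.specialUnitaryGroup (Fin 2) ℂ) := by
  obtain ⟨C, hC⟩ := h n
  refine ⟨max C 0, le_max_right _ _, fun K hK => ?_⟩
  have hmap := map_descendTo_restrict_eq_withDensity F hK MeasurableSet.univ hγ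
  rw [Measure.restrict_univ] at hmap
  rw [hmap, ← withDensity_const]
  refine withDensity_mono ?_
  filter_upwards [hC K hK] with V hV
  exact ENNReal.ofReal_le_ofReal (hV.trans (le_max_left _ _))

/-- **Bounded test functions**: under `HeightwiseUpperBound` (`γ ≥ 0`), for every height `n` there is `C ≥ 0` such that for every run
`K ≥ n` and every measurable `g ≥ 0`, `∫⁻ g d((D_{n,K})_*Gibbs_K) ≤ C·∫⁻ g dU^{(n)}` — the integrated form of the domination. [cite: Balaban1985UV3, (5)-(6) pp.256-257] -/
theorem lintegral_map_descendTo_le (hγ : 0 ≤ γ) (h : HeightwiseUpperBound F γ) (n : ℕ) :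
    ∃ C : ℝ, 0 ≤ C ∧ ∀ (K : ℕ) (hK : n ≤ K) (g : GaugeField (F.P n) 0 (Matrix.specialUnitaryGroup (Fin 2) ℂ) → ENNReal),
      ∫⁻ V, g V ∂(Measure.map (descendTo F ℰp n K hK) (gibbsK F ℰp γ K)) ≤
        ENNReal.ofReal C * ∫⁻ V, g V ∂(fieldMeasure (F.P n) 0 (Matrix.specialUnitaryGroup (Fin 2) ℂ)) := by
  obtain ⟨C, hC0, hC⟩ := map_descendTo_le_smul_fieldMeasure hγ h n
  refine ⟨C, hC0, fun K hK g => ?_⟩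
  calc ∫⁻ V, g V ∂(Measure.map (descendTo F ℰp n K hK) (gibbsK F ℰp γ K))
      ≤ ∫⁻ V, g V ∂(ENNReal.ofReal C • fieldMeasure (F.P n) 0 (Matrix.specialUnitaryGroup (Fin 2) ℂ)) :=
        lintegral_mono' (hC K hK) le_rfl
    _ = ENNReal.ofReal C * ∫⁻ V, g V ∂(fieldMeasure (F.P n) 0 (Matrix.specialUnitaryGroup (Fin 2) ℂ)) := by
        rw [lintegral_smul_measure, smul_eq_mul]

end Literature.MathematicalPhysics.QuantumFieldTheory.Balaban1983to89.T3HeightwiseDensityBounds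

end
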